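import Summits.AnomalousDissipation.AnomalousDissipation.Theorems.SawtoothPulseCascadeK1LocalisedCascadeFamilyStep
import Summits.AnomalousDissipation.AnomalousDissipation.Theorems.SawtoothPulseCascadeK1LocalisedCascadeInputSplit
import Summits.AnomalousDissipation.AnomalousDissipation.Theorems.SawtoothPulseCascadeK1LocalisedCascadeEnergyLedgerStep

/-!
# K1loc, line `Spectral` / SeqCone — helper: ONE V HALF-SLOT OF THE ENERGY LEDGER, ASSEMBLED (S-C′ step, concrete)

Helper file of the prover lane on the crux `K1LocalisedCascade` (stmt-AnomalousDissipation-19491), route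
`SawtoothPulseCascade`, registered stub `stub_highModeConcentration` (memo v7 §2).  The landed bricks of one half-slot —
input split (`…InputSplit`), the two family steps (`…FamilyStep.sqrt_tsum_symbol_sq_family_step_V`), the slot switch in
energy (`…EnergySwitch.tsum_symbol_sq_switch_le`) and the recombination (`…EnergyLedgerStep.ledger_step`) — are composed
into ONE inequality for the TRUE classical cascade scalar `w` across the V half-slot of phase `j`
(`t₀ = tStart j + tHalf j`, `t₁ = tStart (j+1)`; companion of `…EnergyStepH`): with the carrier `X̂` (coordinate `x₀`) of this
slot and `X̂′` (coordinate `x₁`) of the next (H) half-slot,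
  `Σ m²|𝓕(X̂′(x₁)·w(t₁))|² ≤ (√Σ μ²|𝓕(X̂(x₀)·w(t₀))|² + a₁ + √2·(a₂ + c′))² + R`,
  `a₁ = √(E₊²+E₋²)·‖X̂ w(t₀)‖` (keep-form commutators of the input split), `a₂ = (E_slot + A + √(2C))·‖w(t₀)‖` (slot lemma +
  un-gauging), `c′ = (Σ om|𝓕X̂′|)·‖w(t₁)‖` (carrier insertion), `R = 2(Σ om₂|𝓕X⁺|)‖X̂′w(t₁)‖² + M²B²·vol{X⁺+X⁻ ≠ 1}
  + 2((Σ om₂|𝓕(X⁺+X⁻)|)‖X̂′w(t₁)‖² + M²‖X̂′w(t₁)‖(B/4)√vol{0 < X⁺+X⁻ < 1})`, `|w(t₁)| ≤ B`.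
This is the shape `T_{s+1}² ≤ (T_s + α_s)² + β_s` of `…ZoneReadmit.sq_ledger_le`; all cut-offs, symbols and constants are
abstract (S-B supplies them).  `energy_ledger_step_V` below (`…EnergyStepH.energy_ledger_step_H` is the H half-slot).

WHAT THIS IS NOT: no statement about the stub itself; no choice of cut-offs/symbols (S-B), no iteration (S-C′), no first
good piece (S-D). [cite: BedrossianCotiZelati2017, §2 (energy method in shear coordinates)]
[cite: Grafakos2014, Prop. 3.1.2 (5) and Prop. 3.2.7 (3)] [problem: turb]
-/

-- `Summit.<Summit>.<Problem>`: single-conjunct summit, the duplicate namespace segment is deliberate.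
set_option linter.dupNamespace false

noncomputable section

namespace Summit.AnomalousDissipation.AnomalousDissipation.Theorems.SawtoothPulseCascade.K1Slot

open MeasureTheory Set Filter Topology UnitAddTorus Function Complex
open scoped ContDiff ComplexConjugate
open Literature.Analysis Literature.Analysis.FunctionSpaces Literature.Analysis.FunctionSpaces.Torus
open Literature.Analysis.FluidPDE.ShearStage
open Literature.Analysis.FluidPDE.SawtoothCascade Literature.Analysis.FluidPDE.SawtoothCascade.CascadeParams
open Summit.AnomalousDissipation.AnomalousDissipation.Theorems.SawtoothPulseCascade.SpectralLeakage

section Cascade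

variable (P : CascadeParams)

/-- **One V half-slot of the energy ledger for the true solution** (indices swapped: cut-offs of this slot read `x₀`, the next carrier reads `x₁`, `t₀ = tStart j + tHalf j`, `t₁ = tStart (j+1)`). **Data**  Data (all abstract): the slot's derivative profile
`Q = U_j′`; for each family `σ = ±1` the slot-lemma cut-off `X̃^σ` (with derivative profile, bounds `C₁, C₂`, flatness `ε₁`),
the un-gauging cut-off `X^σ` (`X^σX̃^σ = X^σ`), the per-fibre estimate `hfib` (constants `A, C`); the disjointness
`X⁺X⁻ = 0`, `|X⁻| ≤ 1`, `X⁺ + X⁻ ∈ [0,1]`; the carrier `X̂` of this slot (`X̃^σX̂ = X̃^σ`, `|X̃⁺|²+|X̃⁻|² ≤ 1`) with the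
keep-form input-split bounds `hcp/hcm` (constants `E₊, E₋`); the carrier `X̂′` of the next slot (`|X̂′| ≤ 1`); the old symbol
`μ` (`|μ| ≤ 1`), the new symbol `m` (`|m| ≤ M`) with moduli `om` (of `m`) and `om₂` (of `m²`); a classical cascade scalar `w`
on `[0,1)` with `|w(t₁)| ≤ B`.  Conclusion: the displayed ledger inequality (module docstring).
[cite: BedrossianCotiZelati2017, §2] [cite: Grafakos2014, Prop. 3.1.2 (5) and Prop. 3.2.7 (3)] -/
theorem energy_ledger_step_V (hγ : 0 ≤ P.γ) (hδ₀ : 0 < P.δ₀) (hd : 0 < P.d) (j : ℕ)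
    (Q : ShearProfile) (hQ : ∀ y, Q y = deriv (P.U j) y)
    {κ ε₁ C₁ C₂ : ℝ} (hκ : 0 ≤ κ) (hε₁ : 0 ≤ ε₁) (hγε : P.γ * ε₁ ≤ 1)
    -- family `+`
    (Xsp Xsdp Xp : ShearProfile) (hXsdp : ∀ y, Xsdp y = deriv Xsp y) (hXsp1 : ∀ y, |Xsp y| ≤ 1)
    (hC₁p : ∀ y, |Xsdp y| ≤ C₁) (hC₂p : ∀ y, |deriv Xsdp y| ≤ C₂)
    (hflatp : ∀ y, Xsp y ≠ 0 ∨ Xsdp y ≠ 0 → |Q y - 1| ≤ ε₁) (hXXsp : ∀ y, Xp y * Xsp y = Xp y)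
    -- family `−`
    (Xsm Xsdm Xm : ShearProfile) (hXsdm : ∀ y, Xsdm y = deriv Xsm y) (hXsm1 : ∀ y, |Xsm y| ≤ 1)
    (hC₁m : ∀ y, |Xsdm y| ≤ C₁) (hC₂m : ∀ y, |deriv Xsdm y| ≤ C₂)
    (hflatm : ∀ y, Xsm y ≠ 0 ∨ Xsdm y ≠ 0 → |Q y - (-1)| ≤ ε₁) (hXXsm : ∀ y, Xm y * Xsm y = Xm y)
    (Z : ShearProfile) (hZ : ∀ y, Z y = 0)
    -- the two families: disjoint, `|X⁻| ≤ 1`, total in `[0,1]`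
    (hdis : ∀ y, Xp y * Xm y = 0) (hXm1 : ∀ y, |Xm y| ≤ 1) (hX0 : ∀ y, 0 ≤ Xp y + Xm y) (hX1 : ∀ y, Xp y + Xm y ≤ 1)
    -- carrier of this slot and sub-partition
    (Xc : ShearProfile) (hXcXsp : ∀ y, Xsp y * Xc y = Xsp y) (hXcXsm : ∀ y, Xsm y * Xc y = Xsm y)
    (hpart : ∀ y, Xsp y ^ 2 + Xsm y ^ 2 ≤ 1)
    -- carrier of the next slot
    (Xc' : ShearProfile) (hXc'1 : ∀ y, |Xc' y| ≤ 1)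
    -- the solution
    {w : ℝ → UnitAddTorus (Fin 2) → ℝ} (hw : FluidPDE.Torus.IsClassicalScalarTransportOn (Ico 0 1) κ P.field w)
    {B : ℝ} (hB : ∀ x, |w (tStart (j + 1)) x| ≤ B)
    -- symbols
    {μ m : (Fin 2 → ℤ) → ℝ} (hμ1 : ∀ k, |μ k| ≤ 1) {M : ℝ} (hmM : ∀ k, |m k| ≤ M)
    {om : (Fin 2 → ℤ) → ℝ} (hom0 : ∀ n, 0 ≤ om n) (hom : ∀ k n, |m k - m (k - n)| ≤ om n)
    (homs : Summable fun n => om n * ‖mFourierCoeff (fun x : UnitAddTorus (Fin 2) => (Xc'.onCircle (x 1) : ℂ)) n‖)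
    {om₂ : (Fin 2 → ℤ) → ℝ} (hom20 : ∀ n, 0 ≤ om₂ n) (hom2 : ∀ k n, |m k ^ 2 - m (k - n) ^ 2| ≤ om₂ n)
    (hom2p : Summable fun n => om₂ n * ‖mFourierCoeff (fun x : UnitAddTorus (Fin 2) => (Xp.onCircle (x 0) : ℂ)) n‖)
    (hom2s : Summable fun n => om₂ n *
      ‖mFourierCoeff (fun x : UnitAddTorus (Fin 2) => (Xp.onCircle (x 0) : ℂ) + Xm.onCircle (x 0)) n‖)
    -- un-gauging data (per family) and input-split data
    {A C : ℝ} (hA0 : 0 ≤ A) (hC0 : 0 ≤ C)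
    (hfibp : ∀ n : ℤ, ∀ G : UnitAddTorus (Fin 2) → ℂ, IsSmooth G → (∀ k, mFourierCoeff G k ≠ 0 → k 1 = n) →
      ∑' k, m k ^ 2 * ‖mFourierCoeff (fun x => ((Xp.onCircle (x 0) : ℂ) + Z.onCircle (x 0)) *
          G (shearMap 1 0 (amp ⟨P.U j, P.U_periodic j, P.contDiff_U (P.δ_pos hδ₀ hd j)⟩ P.γ) x)) k‖ ^ 2 ≤
        (Real.sqrt (∑' k, μ k ^ 2 * ‖mFourierCoeff G k‖ ^ 2) + A * Real.sqrt (∫ x, ‖G x‖ ^ 2)) ^ 2 +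
          2 * C * ∫ x, ‖G x‖ ^ 2)
    (hfibm : ∀ n : ℤ, ∀ G : UnitAddTorus (Fin 2) → ℂ, IsSmooth G → (∀ k, mFourierCoeff G k ≠ 0 → k 1 = n) →
      ∑' k, m k ^ 2 * ‖mFourierCoeff (fun x => ((Xm.onCircle (x 0) : ℂ) + Z.onCircle (x 0)) *
          G (shearMap 1 0 (amp ⟨P.U j, P.U_periodic j, P.contDiff_U (P.δ_pos hδ₀ hd j)⟩ P.γ) x)) k‖ ^ 2 ≤
        (Real.sqrt (∑' k, μ k ^ 2 * ‖mFourierCoeff G k‖ ^ 2) + A * Real.sqrt (∫ x, ‖G x‖ ^ 2)) ^ 2 +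
          2 * C * ∫ x, ‖G x‖ ^ 2)
    {Ep Em : ℝ} (hEp : 0 ≤ Ep) (hEm : 0 ≤ Em)
    (hcp : Real.sqrt (∑' k, μ k ^ 2 * ‖mFourierCoeff (fun x => (Xsp.onCircle (x 0) : ℂ) *
        ((Xc.onCircle (x 0) * w (tStart j + tHalf j) x : ℝ) : ℂ)) k‖ ^ 2) ≤
      Real.sqrt (∫ x, ‖(Xsp.onCircle (x 0) : ℂ) * fourierSynth (fun k => (μ k : ℂ) *
        mFourierCoeff (fun x => ((Xc.onCircle (x 0) * w (tStart j + tHalf j) x : ℝ) : ℂ)) k) x‖ ^ 2) +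
        Ep * Real.sqrt (∫ x, ‖((Xc.onCircle (x 0) * w (tStart j + tHalf j) x : ℝ) : ℂ)‖ ^ 2))
    (hcm : Real.sqrt (∑' k, μ k ^ 2 * ‖mFourierCoeff (fun x => (Xsm.onCircle (x 0) : ℂ) *
        ((Xc.onCircle (x 0) * w (tStart j + tHalf j) x : ℝ) : ℂ)) k‖ ^ 2) ≤
      Real.sqrt (∫ x, ‖(Xsm.onCircle (x 0) : ℂ) * fourierSynth (fun k => (μ k : ℂ) *
        mFourierCoeff (fun x => ((Xc.onCircle (x 0) * w (tStart j + tHalf j) x : ℝ) : ℂ)) k) x‖ ^ 2) +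
        Em * Real.sqrt (∫ x, ‖((Xc.onCircle (x 0) * w (tStart j + tHalf j) x : ℝ) : ℂ)‖ ^ 2)) :
    ∑' k, m k ^ 2 * ‖mFourierCoeff (fun x => ((Xc'.onCircle (x 1) * w (tStart (j + 1)) x : ℝ) : ℂ)) k‖ ^ 2 ≤
      (Real.sqrt (∑' k, μ k ^ 2 * ‖mFourierCoeff (fun x => ((Xc.onCircle (x 0) * w (tStart j + tHalf j) x : ℝ) : ℂ)) k‖ ^ 2) +
          Real.sqrt (Ep ^ 2 + Em ^ 2) * Real.sqrt (∫ x, ‖((Xc.onCircle (x 0) * w (tStart j + tHalf j) x : ℝ) : ℂ)‖ ^ 2) +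
          Real.sqrt 2 *
            ((2 * κ * tHalf j * C₂ + 4 * C₁ * Real.sqrt (κ * tHalf j / 2) +
                Real.sqrt (P.γ * ε₁ * (5 + 6 * C₁ ^ 2 * κ * tHalf j)) + A + Real.sqrt (2 * C)) *
              Real.sqrt (FluidPDE.Torus.scalarL2Sq (w (tStart j + tHalf j))) +
            (∑' n, om n * ‖mFourierCoeff (fun x : UnitAddTorus (Fin 2) => (Xc'.onCircle (x 1) : ℂ)) n‖) *
              Real.sqrt (FluidPDE.Torus.scalarL2Sq (w (tStart (j + 1)))))) ^ 2 +
      (2 * ((∑' n, om₂ n * ‖mFourierCoeff (fun x : UnitAddTorus (Fin 2) => (Xp.onCircle (x 0) : ℂ)) n‖) *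
          ∫ x, ‖(Xc'.onCircle (x 1) : ℂ) * (w (tStart (j + 1)) x : ℂ)‖ ^ 2) +
        M ^ 2 * (B ^ 2 * volume.real {x : UnitAddTorus (Fin 2) | Xp.onCircle (x 0) + Xm.onCircle (x 0) ≠ 1}) +
        2 * ((∑' n, om₂ n * ‖mFourierCoeff (fun x : UnitAddTorus (Fin 2) => (Xp.onCircle (x 0) : ℂ) + Xm.onCircle (x 0)) n‖) *
            (∫ x, ‖(Xc'.onCircle (x 1) : ℂ) * (w (tStart (j + 1)) x : ℂ)‖ ^ 2) +
          M ^ 2 * Real.sqrt (∫ x, ‖(Xc'.onCircle (x 1) : ℂ) * (w (tStart (j + 1)) x : ℂ)‖ ^ 2) *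
            ((B / 4) * Real.sqrt (volume.real {x : UnitAddTorus (Fin 2) |
              Xp.onCircle (x 0) + Xm.onCircle (x 0) ≠ 0 ∧ Xp.onCircle (x 0) + Xm.onCircle (x 0) ≠ 1})))) := by
  set t₀ : ℝ := tStart j + tHalf j with ht₀
  set t₁ : ℝ := tStart (j + 1) with ht₁
  have ht₀mem : t₀ ∈ Ico (0 : ℝ) 1 := ⟨by rw [ht₀]; linarith [tStart_nonneg j, tHalf_pos j], tStart_add_tHalf_lt_one j⟩
  have ht₁mem : t₁ ∈ Ico (0 : ℝ) 1 := ⟨tStart_nonneg (j + 1), tStart_lt_one (j + 1)⟩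
  have hwt₀ : IsSmooth (w t₀) := hw.smooth_scalar.isSmooth_slice ht₀mem
  have hwt₁ : IsSmooth (w t₁) := hw.smooth_scalar.isSmooth_slice ht₁mem
  -- lifting profile facts to the circle
  have lift : ∀ {R : ShearProfile} {p : ℝ → Prop}, (∀ y, p (R y)) → ∀ b : UnitAddCircle, p (R.onCircle b) := by
    intro R p h b
    obtain ⟨y, rfl⟩ := QuotientAddGroup.mk_surjective b
    rw [ShearProfile.onCircle_coe]; exact h y
  have lift2 : ∀ {R S : ShearProfile} {p : ℝ → ℝ → Prop}, (∀ y, p (R y) (S y)) →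
      ∀ b : UnitAddCircle, p (R.onCircle b) (S.onCircle b) := by
    intro R S p h b
    obtain ⟨y, rfl⟩ := QuotientAddGroup.mk_surjective b
    rw [ShearProfile.onCircle_coe, ShearProfile.onCircle_coe]; exact h y
  -- (i) the two family steps (true solution)
  have hOp := sqrt_tsum_symbol_sq_family_step_V P hγ hδ₀ hd j Q Xsp Xsdp hQ hXsdp (σ := 1) hκ hε₁ hγε hXsp1 hC₁p hC₂p
    hflatp Xp Z hXXsp hZ hw hμ1 hmM hA0 hC0 hfibp
  have hOm := sqrt_tsum_symbol_sq_family_step_V P hγ hδ₀ hd j Q Xsm Xsdm hQ hXsdm (σ := -1) hκ hε₁ hγε hXsm1 hC₁m hC₂m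
    hflatm Xm Z hXXsm hZ hw hμ1 hmM hA0 hC0 hfibm
  -- (ii) the input split on `F = X̂ w(t₀)` with `Θ^σ = X̃^σ`
  set F : UnitAddTorus (Fin 2) → ℂ := fun x => ((Xc.onCircle (x 0) * w t₀ x : ℝ) : ℂ) with hF_def
  have hFsm : IsSmooth F := by
    have : F = fun x => ((Xc.onCircle (x 0) : ℝ) : ℂ) * ((w t₀ x : ℝ) : ℂ) := by
      funext x; simp only [hF_def, Complex.ofReal_mul]
    rw [this]; exact (isSmooth_onCircle_comp' Xc 0).ofReal_comp.mul hwt₀.ofReal_comp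
  have hΘp : Continuous fun x : UnitAddTorus (Fin 2) => (Xsp.onCircle (x 0) : ℂ) :=
    Complex.continuous_ofReal.comp (Xsp.continuous_onCircle.comp (continuous_apply 0))
  have hΘm : Continuous fun x : UnitAddTorus (Fin 2) => (Xsm.onCircle (x 0) : ℂ) :=
    Complex.continuous_ofReal.comp (Xsm.continuous_onCircle.comp (continuous_apply 0))
  have hpart' : ∀ x : UnitAddTorus (Fin 2), ‖(Xsp.onCircle (x 0) : ℂ)‖ ^ 2 + ‖(Xsm.onCircle (x 0) : ℂ)‖ ^ 2 ≤ 1 := by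
    intro x
    rw [Complex.norm_real, Complex.norm_real, Real.norm_eq_abs, Real.norm_eq_abs, sq_abs, sq_abs]
    exact lift2 (p := fun a b => a ^ 2 + b ^ 2 ≤ 1) hpart (x 0)
  have hsplit := sqrt_add_sq_symbol_mul_le_of_partition (F := F) hFsm.rapidDecay_mFourierCoeff.summable_norm hΘp hΘm hpart'
    hμ1 hEp hEm hcp hcm
  -- `Θ^σ F = X̃^σ w(t₀)`
  have hΘF : ∀ (Xs : ShearProfile), (∀ y, Xs y * Xc y = Xs y) →
      (fun x => (Xs.onCircle (x 0) : ℂ) * F x) = fun x => ((Xs.onCircle (x 0) * w t₀ x : ℝ) : ℂ) := by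
    intro Xs h; funext x
    have h' : Xs.onCircle (x 0) * Xc.onCircle (x 0) = Xs.onCircle (x 0) := lift2 (p := fun a b => a * b = a) h (x 0)
    simp only [hF_def]; push_cast
    rw [← mul_assoc, ← Complex.ofReal_mul, h']
  rw [hΘF Xsp hXcXsp, hΘF Xsm hXcXsm] at hsplit
  -- (iii) the switch, with `v = w(t₁)`
  have hv : IsSmooth (fun x : UnitAddTorus (Fin 2) => ((w t₁ x : ℝ) : ℂ)) := hwt₁.ofReal_comp
  have hXpS : IsSmooth (fun x : UnitAddTorus (Fin 2) => ((Xp.onCircle (x 0) : ℝ) : ℂ)) :=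
    (isSmooth_onCircle_comp' Xp 0).ofReal_comp
  have hXmS : IsSmooth (fun x : UnitAddTorus (Fin 2) => ((Xm.onCircle (x 0) : ℝ) : ℂ)) :=
    (isSmooth_onCircle_comp' Xm 0).ofReal_comp
  have hXc'S : IsSmooth (fun x : UnitAddTorus (Fin 2) => ((Xc'.onCircle (x 1) : ℝ) : ℂ)) :=
    (isSmooth_onCircle_comp' Xc' 1).ofReal_comp
  have hXc'1' : ∀ x : UnitAddTorus (Fin 2), ‖((Xc'.onCircle (x 1) : ℝ) : ℂ)‖ ≤ 1 := fun x => by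
    rw [Complex.norm_real, Real.norm_eq_abs]; exact lift (p := fun a => |a| ≤ 1) hXc'1 (x 1)
  have hXm1' : ∀ x : UnitAddTorus (Fin 2), ‖((Xm.onCircle (x 0) : ℝ) : ℂ)‖ ≤ 1 := fun x => by
    rw [Complex.norm_real, Real.norm_eq_abs]; exact lift (p := fun a => |a| ≤ 1) hXm1 (x 0)
  have hdis' : ∀ x : UnitAddTorus (Fin 2), conj ((Xp.onCircle (x 0) : ℝ) : ℂ) * ((Xm.onCircle (x 0) : ℝ) : ℂ) = 0 :=
    fun x => by
    rw [Complex.conj_ofReal, ← Complex.ofReal_mul, lift2 (p := fun a b => a * b = 0) hdis (x 0), Complex.ofReal_zero]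
  have hXp_c : Continuous fun x : UnitAddTorus (Fin 2) => Xp.onCircle (x 0) :=
    Xp.continuous_onCircle.comp (continuous_apply 0)
  have hXm_c : Continuous fun x : UnitAddTorus (Fin 2) => Xm.onCircle (x 0) :=
    Xm.continuous_onCircle.comp (continuous_apply 0)
  have hθc : Continuous fun x : UnitAddTorus (Fin 2) => Xp.onCircle (x 0) + Xm.onCircle (x 0) := hXp_c.add hXm_c
  have hθ0 : ∀ x : UnitAddTorus (Fin 2), 0 ≤ Xp.onCircle (x 0) + Xm.onCircle (x 0) :=
    fun x => lift2 (p := fun a b => 0 ≤ a + b) hX0 (x 0)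
  have hθ1 : ∀ x : UnitAddTorus (Fin 2), Xp.onCircle (x 0) + Xm.onCircle (x 0) ≤ 1 :=
    fun x => lift2 (p := fun a b => a + b ≤ 1) hX1 (x 0)
  have hXθ : ∀ x : UnitAddTorus (Fin 2), ((Xp.onCircle (x 0) : ℝ) : ℂ) + ((Xm.onCircle (x 0) : ℝ) : ℂ) =
      (((fun y : UnitAddTorus (Fin 2) => Xp.onCircle (y 0) + Xm.onCircle (y 0)) x : ℝ) : ℂ) :=
    fun x => by push_cast; ring
  have hvB : ∀ x : UnitAddTorus (Fin 2), ‖((w t₁ x : ℝ) : ℂ)‖ ≤ B := fun x => by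
    rw [Complex.norm_real, Real.norm_eq_abs]; exact hB x
  have hsw := tsum_symbol_sq_switch_le hv hXpS hXmS hXc'S hXc'1' hXm1' hdis' hθc hθ0 hθ1 hXθ hvB hmM hom0 hom homs
    hom20 hom2 hom2p hom2s
  beta_reduce at hsw
  -- rewrite the functions of `hsw` into the `((· : ℝ) : ℂ)` product form
  have eP : (fun x : UnitAddTorus (Fin 2) => ((Xp.onCircle (x 0) : ℝ) : ℂ) * ((w t₁ x : ℝ) : ℂ)) =
      fun x => ((Xp.onCircle (x 0) * w t₁ x : ℝ) : ℂ) := by funext x; push_cast; ring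
  have eM : (fun x : UnitAddTorus (Fin 2) => ((Xm.onCircle (x 0) : ℝ) : ℂ) * ((w t₁ x : ℝ) : ℂ)) =
      fun x => ((Xm.onCircle (x 0) * w t₁ x : ℝ) : ℂ) := by funext x; push_cast; ring
  have eC : (fun x : UnitAddTorus (Fin 2) => ((Xc'.onCircle (x 1) : ℝ) : ℂ) * ((w t₁ x : ℝ) : ℂ)) =
      fun x => ((Xc'.onCircle (x 1) * w t₁ x : ℝ) : ℂ) := by funext x; push_cast; ring
  rw [eP, eM] at hsw
  -- norms: `‖X^σ v‖ ≤ ‖w(t₁)‖`, `∫|F|² ≤ …` is kept as is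
  have hL2 : ∀ (R : ShearProfile), (∀ y, |R y| ≤ 1) →
      Real.sqrt (∫ x, ‖(R.onCircle (x 0) : ℂ) * (w t₁ x : ℂ)‖ ^ 2) ≤ Real.sqrt (FluidPDE.Torus.scalarL2Sq (w t₁)) := by
    intro R hR
    refine Real.sqrt_le_sqrt ?_
    unfold FluidPDE.Torus.scalarL2Sq
    have hRc : Continuous fun x : UnitAddTorus (Fin 2) => (R.onCircle (x 0) : ℂ) :=
      Complex.continuous_ofReal.comp (R.continuous_onCircle.comp (continuous_apply 0))
    have hprod_c : Continuous fun x : UnitAddTorus (Fin 2) => (R.onCircle (x 0) : ℂ) * (w t₁ x : ℂ) :=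
      hRc.mul (Complex.continuous_ofReal.comp hwt₁.continuous)
    refine integral_mono (hprod_c.norm.pow 2).integrable_unitAddTorus ((hwt₁.continuous.pow 2).integrable_unitAddTorus)
      fun x => ?_
    have hR' : |R.onCircle (x 0)| ≤ 1 := lift (p := fun a => |a| ≤ 1) hR (x 0)
    have hR2 : (R.onCircle (x 0)) ^ 2 ≤ 1 := by
      rw [← sq_abs]; exact pow_le_one₀ (abs_nonneg _) hR'
    show ‖(R.onCircle (x 0) : ℂ) * (w t₁ x : ℂ)‖ ^ 2 ≤ (w t₁ x) ^ 2
    rw [norm_mul, Complex.norm_real, Complex.norm_real, Real.norm_eq_abs, Real.norm_eq_abs, mul_pow, sq_abs, sq_abs]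
    calc (R.onCircle (x 0)) ^ 2 * (w t₁ x) ^ 2 ≤ 1 * (w t₁ x) ^ 2 := mul_le_mul_of_nonneg_right hR2 (sq_nonneg _)
      _ = (w t₁ x) ^ 2 := one_mul _
  have hXp1 : ∀ y, |Xp y| ≤ 1 := fun y => by
    have h0 := hX0 y; have h1 := hX1 y; have hd' := hdis y
    -- `Xp ∈ [0,1]` need not hold pointwise in general; use `|Xp| ≤ 1` from `Xp·Xsp = Xp`, `|Xsp| ≤ 1`? Not available;
    -- instead: Xp y * Xm y = 0 ⇒ Xp y = 0 ∨ Xm y = 0; in either case Xp y = (Xp y + Xm y) - Xm y ∈ [-1, 1].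
    rcases mul_eq_zero.mp hd' with h | h
    · rw [h, abs_zero]; exact zero_le_one
    · rw [h, add_zero] at h0 h1; rw [abs_le]; constructor <;> linarith
  -- (iv) recombine
  set T₀ := Real.sqrt (∑' k, μ k ^ 2 * ‖mFourierCoeff F k‖ ^ 2) with hT₀
  set Ip := Real.sqrt (∑' k, μ k ^ 2 * ‖mFourierCoeff (fun x => ((Xsp.onCircle (x 0) * w t₀ x : ℝ) : ℂ)) k‖ ^ 2) with hIp
  set Im := Real.sqrt (∑' k, μ k ^ 2 * ‖mFourierCoeff (fun x => ((Xsm.onCircle (x 0) * w t₀ x : ℝ) : ℂ)) k‖ ^ 2) with hIm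
  set Op := Real.sqrt (∑' k, m k ^ 2 * ‖mFourierCoeff (fun x => ((Xp.onCircle (x 0) * w t₁ x : ℝ) : ℂ)) k‖ ^ 2) with hOp'
  set Om := Real.sqrt (∑' k, m k ^ 2 * ‖mFourierCoeff (fun x => ((Xm.onCircle (x 0) * w t₁ x : ℝ) : ℂ)) k‖ ^ 2) with hOm'
  set Esl : ℝ := 2 * κ * tHalf j * C₂ + 4 * C₁ * Real.sqrt (κ * tHalf j / 2) +
      Real.sqrt (P.γ * ε₁ * (5 + 6 * C₁ ^ 2 * κ * tHalf j)) + A + Real.sqrt (2 * C) with hEsl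
  set a₂ : ℝ := Esl * Real.sqrt (FluidPDE.Torus.scalarL2Sq (w t₀)) with ha₂
  set com : ℝ := ∑' n, om n * ‖mFourierCoeff (fun x : UnitAddTorus (Fin 2) => (Xc'.onCircle (x 1) : ℂ)) n‖ with hcom
  set c : ℝ := com * Real.sqrt (FluidPDE.Torus.scalarL2Sq (w t₁)) with hc
  have hcom0 : 0 ≤ com := tsum_nonneg fun n => mul_nonneg (hom0 n) (norm_nonneg _)
  have hEsl0 : 0 ≤ Esl := by
    have hC₁0 : 0 ≤ C₁ := (abs_nonneg _).trans (hC₁p 0)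
    have hC₂0 : 0 ≤ C₂ := (abs_nonneg _).trans (hC₂p 0)
    have := tHalf_pos j
    rw [hEsl]; positivity
  have ha₂0 : 0 ≤ a₂ := mul_nonneg hEsl0 (Real.sqrt_nonneg _)
  have hc0 : 0 ≤ c := mul_nonneg hcom0 (Real.sqrt_nonneg _)
  -- the switch bound with the common `c`
  have hswitch' : ∑' k, m k ^ 2 * ‖mFourierCoeff (fun x => ((Xc'.onCircle (x 1) * w t₁ x : ℝ) : ℂ)) k‖ ^ 2 ≤
      (Op + c) ^ 2 + (Om + c) ^ 2 +
      (2 * ((∑' n, om₂ n * ‖mFourierCoeff (fun x : UnitAddTorus (Fin 2) => (Xp.onCircle (x 0) : ℂ)) n‖) *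
          ∫ x, ‖(Xc'.onCircle (x 1) : ℂ) * (w t₁ x : ℂ)‖ ^ 2) +
        M ^ 2 * (B ^ 2 * volume.real {x : UnitAddTorus (Fin 2) | Xp.onCircle (x 0) + Xm.onCircle (x 0) ≠ 1}) +
        2 * ((∑' n, om₂ n * ‖mFourierCoeff (fun x : UnitAddTorus (Fin 2) => (Xp.onCircle (x 0) : ℂ) + Xm.onCircle (x 0)) n‖) *
            (∫ x, ‖(Xc'.onCircle (x 1) : ℂ) * (w t₁ x : ℂ)‖ ^ 2) +
          M ^ 2 * Real.sqrt (∫ x, ‖(Xc'.onCircle (x 1) : ℂ) * (w t₁ x : ℂ)‖ ^ 2) *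
            ((B / 4) * Real.sqrt (volume.real {x : UnitAddTorus (Fin 2) |
              Xp.onCircle (x 0) + Xm.onCircle (x 0) ≠ 0 ∧ Xp.onCircle (x 0) + Xm.onCircle (x 0) ≠ 1})))) := by
    rw [← eC]
    have hcp' : com * Real.sqrt (∫ x, ‖(Xp.onCircle (x 0) : ℂ) * (w t₁ x : ℂ)‖ ^ 2) ≤ c :=
      mul_le_mul_of_nonneg_left (hL2 Xp hXp1) hcom0
    have hcm' : com * Real.sqrt (∫ x, ‖(Xm.onCircle (x 0) : ℂ) * (w t₁ x : ℂ)‖ ^ 2) ≤ c :=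
      mul_le_mul_of_nonneg_left (hL2 Xm hXm1) hcom0
    have hOp0 : 0 ≤ Op := Real.sqrt_nonneg _
    have hOm0 : 0 ≤ Om := Real.sqrt_nonneg _
    have h1 : (Op + com * Real.sqrt (∫ x, ‖(Xp.onCircle (x 0) : ℂ) * (w t₁ x : ℂ)‖ ^ 2)) ^ 2 ≤ (Op + c) ^ 2 :=
      pow_le_pow_left₀ (by positivity) (by linarith) 2
    have h2 : (Om + com * Real.sqrt (∫ x, ‖(Xm.onCircle (x 0) : ℂ) * (w t₁ x : ℂ)‖ ^ 2)) ^ 2 ≤ (Om + c) ^ 2 :=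
      pow_le_pow_left₀ (by positivity) (by linarith) 2
    linarith [hsw, h1, h2]
  have hIp0 : 0 ≤ ∑' k, μ k ^ 2 * ‖mFourierCoeff (fun x => ((Xsp.onCircle (x 0) * w t₀ x : ℝ) : ℂ)) k‖ ^ 2 :=
    tsum_nonneg fun k => by positivity
  have hIm0 : 0 ≤ ∑' k, μ k ^ 2 * ‖mFourierCoeff (fun x => ((Xsm.onCircle (x 0) * w t₀ x : ℝ) : ℂ)) k‖ ^ 2 :=
    tsum_nonneg fun k => by positivity
  have hin : Real.sqrt (Ip ^ 2 + Im ^ 2) ≤ T₀ + Real.sqrt (Ep ^ 2 + Em ^ 2) * Real.sqrt (∫ x, ‖F x‖ ^ 2) := by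
    rw [hIp, hIm, Real.sq_sqrt hIp0, Real.sq_sqrt hIm0]; exact hsplit
  have hS0 : 0 ≤ ∑' k, m k ^ 2 * ‖mFourierCoeff (fun x => ((Xc'.onCircle (x 1) * w t₁ x : ℝ) : ℂ)) k‖ ^ 2 :=
    tsum_nonneg fun k => by positivity
  rw [← Real.sq_sqrt hS0] at hswitch'
  have hstep := ledger_step (T₀ := T₀) (a₁ := Real.sqrt (Ep ^ 2 + Em ^ 2) * Real.sqrt (∫ x, ‖F x‖ ^ 2))
    (Real.sqrt_nonneg _) (Real.sqrt_nonneg _) (Real.sqrt_nonneg _) (Real.sqrt_nonneg _) ha₂0 hc0 hin hOp hOm hswitch'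
  rw [Real.sq_sqrt hS0] at hstep
  exact hstep

end Cascade

end Summit.AnomalousDissipation.AnomalousDissipation.Theorems.SawtoothPulseCascade.K1Slot
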